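import Summits.BirchSwinnertonDyer.BirchSwinnertonDyer.Theorems.PrintCf2RubinValueTwoKatzPeriodNormRigidityCore
import Summits.BirchSwinnertonDyer.BirchSwinnertonDyer.Theorems.PrintCf2RubinValueTwoRubinValueFormulaAtTwoUniqueTransport
import Literature.NumberTheory.EllipticCurves.DeShalit1987.KatzMeasureJZero
import Literature.NumberTheory.EllipticCurves.DeShalit1987.KatzMeasureUnitTwistRing
import Literature.NumberTheory.EllipticCurves.IntSeriesTorsionNodeRigidity
import HarnessLib

set_option linter.dupNamespace false
set_option autoImplicit false

/-!
# `j = 0` TWO-VARIABLE KATZ PERIOD RIGIDITY — THE FRAME SOCKET: two solutions of de Shalit's frame on the infinity types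
# `(−m, 0)` (`IsKatzMeasure₂₀`) at two period triples generate the SAME ideal of `𝒪_{ℂ_p}⟦T₁⟧⟦T₂⟧`, GIVEN a torsion supply

Cell `bsd-print-cf2`, LEAD seat `bsd-line-cf2-p1` g18, crux `PrintCf2.SplitBadTwoRankOneOfFacts` (stmt-20368), print leaf 24720
`KatzDistributionsAtTwoPrint` under director OPTION 1 (build the `j = 0` twin). `--supports stmt-BirchSwinnertonDyer-24720` (helper,
Theses-free). THEOREMS ONLY (no `def`, no named fact, no `sorry`); nothing is closed; BSD is not proved by any of this; no summit
statement is proved by this seat.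

WHY. The ideal consumers of the leaf (23300 / 24721 / 23866) quantify `∀ (Ω, δ, Ω_p) ∀ G₂, IsKatzMeasure₂ … G₂ → clause(G₂)` and are
reduced to ONE period triple by §11 `KatzPeriodRigidity.span_eq_span_DA7` / `powForm_forall_of_oneTriple`. Their `j = 0` twins (the
OPTION-1 statements, with `IsKatzMeasure₂₀` in place of `IsKatzMeasure₂`) need the `j = 0` twin of that rigidity — a SERIES-level
statement for two ARBITRARY period triples. At `j = 0` the interpolation set degenerates in the second variable: along `γ₁` (inertia at
`v`, `p`-adic weight `−m`) the points are nodes `w₁·uᵗ − 1` of a one-unit `u`, along `γ₂` (inertia at `v̄`, weight `0`) only torsion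
points `w₂·ζ − 1` occur, so the closed-disc identity principle behind the full-range proof (`…KatzPeriodRigidityFull`) is silent; the
analytic replacement is `IntSeries.span_eq_span_of_torsion_nodes` (Literature `IntSeriesTorsionNodeRigidity`, over the torsion-point
identity principle `IntSeriesIdentityPrincipleTorsion`).

THIS FILE is the FRAME SOCKET: it isolates, as ONE typed hypothesis, the arithmetic input the lane must supply on a concrete frame —
**the torsion supply**: a one-unit `u` (not a root of unity), principal units `w₁, w₂`, an arithmetic progression of weights
`m_t = m₀ + s·t` (`s > 0`, `m_t ≥ 3`) and, for every `t` and every primitive `pⁿ`-th root of unity `ζ` of level `n > n₀`, an in-range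
character `ρ` (avatar `r` through the pair, `λρ` of type `(−m_t, 0)` unramified off `S ∪ {v̄}`, entire `L`-function) WITH
`r(γ₁) = w₁·uᵗ` and `r(γ₂) = w₂·ζ` — and proves

* ★★ `span_eq_span_of_isKatzMeasure₂₀_of_torsionSupply` — two solutions `G ≠ 0`, `G'` of `IsKatzMeasure₂₀` for the same branch at two
  period triples (`Ω, δ, Ω_p, Ω', Ω_p'` non-zero — `δ'` is idle at `j = 0`) satisfy `Ideal.span {G'} = Ideal.span {G}`;
* `charIdeal_clause_transport_of_isKatzMeasure₂₀_of_torsionSupply` — `∀ I, I = (G) ↔ I = (G')`.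

Proof: at a supplied character the two prescribed values differ by `A^{m_t} = A^{m₀}·(A^s)ᵗ` (`A = ι⁻¹(Ω/Ω')·Ω_p'/Ω_p`,
`KatzPeriodRigidity.padicValue_eq_periodRatio_pow_mul` at `j = 0`); unit-twist both series by `(w₁, w₂)` (`IntSeries.unitTwist₂`) so the
points become `(uᵗ − 1, ζ − 1)`; `IntSeries.norm_eq_one_of_torsion_nodes` gives `‖A^s‖ = 1`, hence `‖A‖ = 1`, hence the constant
`A^{m₀}` is a unit and `IntSeries.span_eq_span_of_torsion_nodes` applies; transport the ideal identity back through the twist (a ring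
automorphism). On the DA7 frame the supply is: the B18s seed (`FrameSeed.exists_seed_core`, type `(−a, 0)`), the everywhere-unramified
type-`(N,0)` powers with avatars through the pair (`CycTangentCMCycTangentBoundPairSupply`), and the finite characters of the
`ℤ₂²`-quotient with prescribed value at `γ₂⁻¹` as Hecke characters (`FiniteOrderHeckeCharacterPadicAvatar`) — the sequel file.

References: [deShalit1987] II.4.12 Remarks (iii)–(iv) (p. 66–67), II.4.16 (49)–(50) (p. 76–77), II.4.17 (52)–(54) (p. 77–78);
[Gouvea1993PadicNumbers] §5.9; [Washington1997] §12.2.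
-/

noncomputable section

open scoped NumberField Classical Topology
open Filter NumberField IsDedekindDomain Field
open Literature Literature.NumberTheory.GaloisRepresentations Literature.NumberTheory.EllipticCurves

namespace Summit.BirchSwinnertonDyer.BirchSwinnertonDyer.Theorems.PrintCf2.KatzPeriodRigidity

variable {p : ℕ} [Fact p.Prime] {K : Type} [Field K] [NumberField K]

/-- A one-unit has norm one. [folklore] -/
private theorem norm_eq_one_of_norm_sub_one_lt {x : ℂ_[p]} (hx : ‖x - 1‖ < 1) : ‖x‖ = 1 := by
  have hh := IsUltrametricDist.norm_add_eq_max_of_norm_ne_norm (x := x - 1) (y := (1 : ℂ_[p]))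
    (by rw [norm_one]; exact hx.ne)
  rw [sub_add_cancel, norm_one] at hh
  rw [hh]
  exact max_eq_right hx.le

/-- **`j = 0` TWO-VARIABLE KATZ PERIOD RIGIDITY, GIVEN A TORSION SUPPLY.** Let `G ≠ 0` and `G'` solve de Shalit's frame on the
infinity types `(−m, 0)` (`IsKatzMeasure₂₀`) for ONE branch `(ι, v, v̄, S, κ₁, κ₂, γ₁, γ₂, λ)` at two period triples `(Ω, δ, Ω_p)`,
`(Ω', δ', Ω_p')` (`Ω, δ, Ω_p, Ω', Ω_p' ≠ 0`; `δ'` is idle at `j = 0`). Suppose the frame carries a TORSION SUPPLY: a one-unit `u ∈ ℂ_p` which is not a root of unity,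
principal units `w₁, w₂`, weights `m₀ + s·t` (`s > 0`), a level `n₀`, and for every `t` and every primitive `pⁿ`-th root of unity `ζ`
(`n > n₀`) a character `ρ` with avatar `r` through the pair, `λρ` of type `(−(m₀ + s·t), 0)` with `3 ≤ m₀ + s·t`, unramified off
`S ∪ {v̄}`, entire `L`-function, `r(γ₁) = w₁·uᵗ`, `r(γ₂) = w₂·ζ`. Then `Ideal.span {G'} = Ideal.span {G}`.
[cite: deShalit1987, II.4.12 Remarks (iii)–(iv) (p. 66–67), II.4.16 (49)–(50) (p. 76–77), II.4.17 (52)–(54) (p. 77–78)]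
[cite: Gouvea1993PadicNumbers, §5.9 Lemma 5.9.1 and Problem 194] -/
theorem span_eq_span_of_isKatzMeasure₂₀_of_torsionSupply
    {ι : PadicAlgCl p ≃+* ℂ} {v vbar : HeightOneSpectrum (𝓞 K)} {S : Finset (HeightOneSpectrum (𝓞 K))}
    {κ₁ κ₂ : ZpExtension K p} {γ₁ γ₂ : absoluteGaloisGroup K} {lam : HeckeCharacter K}
    {Ω δ Ω' δ' : ℂ} {Ωp Ωp' : ℂ_[p]} {G G' : PowerSeries (PowerSeries (PadicComplexInt p))}
    (hG : IsKatzMeasure₂₀ ι v vbar S κ₁ κ₂ γ₁ γ₂ lam Ω δ Ωp G)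
    (hG' : IsKatzMeasure₂₀ ι v vbar S κ₁ κ₂ γ₁ γ₂ lam Ω' δ' Ωp' G')
    (hΩ : Ω ≠ 0) (hδ : δ ≠ 0) (hΩp : Ωp ≠ 0) (hΩ' : Ω' ≠ 0) (hΩp' : Ωp' ≠ 0) (hG0 : G ≠ 0)
    -- the torsion supply
    {u w₁ w₂ : ℂ_[p]} (hu : ‖u - 1‖ < 1) (hroot : ∀ n : ℕ, 0 < n → u ^ n ≠ 1)
    (hw₁ : ‖w₁ - 1‖ < 1) (hw₂ : ‖w₂ - 1‖ < 1) {m₀ s : ℕ} (hs : 0 < s) (n₀ : ℕ)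
    (hsupply : ∀ (t n : ℕ) (ζ : ℂ_[p]), n₀ < n → IsPrimitiveRoot ζ (p ^ n) →
      ∃ (ρ : HeckeCharacter K) (r : FramedGaloisRep K (PadicAlgCl p) 1),
        IsPAdicAvatarOf ι ρ r ∧ FactorsThroughPair κ₁ κ₂ r ∧ 3 ≤ m₀ + s * t ∧
        (lam * ρ).HasInfinityType (fun _ ↦ -((m₀ + s * t : ℕ) : ℤ)) (fun _ ↦ 0) ∧
        (∀ w : HeightOneSpectrum (𝓞 K), w ∉ S → w ≠ vbar → (lam * ρ).IsUnramifiedAt w) ∧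
        LFunction.HasEntireContinuation (heckeLFunction (lam * ρ)) ∧
        avatarValueAt r γ₁ = w₁ * u ^ t ∧ avatarValueAt r γ₂ = w₂ * ζ) :
    Ideal.span {G'} = Ideal.span {G} := by
  -- the period ratio `A` and the node constants `c = A^{m₀}`, `d = A^s`
  set A : ℂ_[p] := (((ι.symm (Ω / Ω')) : PadicAlgCl p) : ℂ_[p]) * (Ωp' / Ωp) with hA
  have hA0 : A ≠ 0 := by
    refine mul_ne_zero ?_ (div_ne_zero hΩp' hΩp)
    rw [PadicComplex.coe_eq]
    exact (map_ne_zero _).mpr ((map_ne_zero _).mpr (div_ne_zero hΩ hΩ'))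
  -- the unit twist by `(w₁, w₂)`
  set a₁ : PadicComplexInt p := ⟨w₁, mem_padicComplexInt_iff.mpr (norm_eq_one_of_norm_sub_one_lt hw₁).le⟩ with ha₁
  set a₂ : PadicComplexInt p := ⟨w₂, mem_padicComplexInt_iff.mpr (norm_eq_one_of_norm_sub_one_lt hw₂).le⟩ with ha₂
  have ha₁' : ‖(a₁ : ℂ_[p]) - 1‖ < 1 := hw₁
  have ha₂' : ‖(a₂ : ℂ_[p]) - 1‖ < 1 := hw₂
  set H := IntSeries.unitTwist₂ G a₁ a₂ with hH
  set H' := IntSeries.unitTwist₂ G' a₁ a₂ with hH'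
  have hH0 : H ≠ 0 := by
    intro h0
    apply hG0
    have htw : IntSeries.unitTwist₂ G a₁ a₂ = IntSeries.unitTwist₂ 0 a₁ a₂ := by
      rw [← hH, h0, ← IntSeries.unitTwist₂RingHom_apply a₁ a₂ ha₁' ha₂' 0, map_zero]
    exact IntSeries.eq_of_unitTwist₂_eq ha₁' ha₂' htw
  -- the values of the twisted series on the set `{(uᵗ − 1, ζ − 1)}`
  have hnode : ∀ t : ℕ, ‖u ^ t - 1‖ < 1 := fun t ↦ by
    have hu1 := norm_eq_one_of_norm_sub_one_lt hu
    refine lt_of_le_of_lt ?_ hu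
    rw [← geom_sum_mul, norm_mul]
    refine mul_le_of_le_one_left (norm_nonneg _) ?_
    refine IsUltrametricDist.norm_sum_le_of_forall_le_of_nonneg zero_le_one fun i _ ↦ ?_
    rw [norm_pow, hu1, one_pow]
  have hvalues : ∀ (t n : ℕ) (ζ : ℂ_[p]), n₀ < n → IsPrimitiveRoot ζ (p ^ n) →
      ∃ x : ℂ_[p], IntSeries.HasValueAt₂ H (u ^ t - 1) (ζ - 1) x ∧
        IntSeries.HasValueAt₂ H' (u ^ t - 1) (ζ - 1) (A ^ m₀ * (A ^ s) ^ t * x) := by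
    intro t n ζ hn hζ
    obtain ⟨ρ, r, hr, hκ, hm, hinf, hunr, hL, hr₁, hr₂⟩ := hsupply t n ζ hn hζ
    have hζ1 : ‖ζ - 1‖ < 1 := IntSeries.norm_sub_one_lt_one_of_isPrimitiveRoot_pow hζ
    -- the two prescribed values
    have hx := hG.hasValueAt₂ hr hκ hm hinf hunr hL
    have hx' := hG'.hasValueAt₂ hr hκ hm hinf hunr hL
    have hrel := padicValue_eq_periodRatio_pow_mul ι v vbar S (lam * ρ) (m₀ + s * t) 0 Ω' δ' (hL.continuation 0) Ωp'
      hΩ hδ hΩp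
    simp only [Nat.add_zero, pow_zero, mul_one] at hrel
    rw [hrel, ← hA] at hx'
    set V : ℂ_[p] := (((ι.symm (DeShalit1987.interpolationValue p v vbar S (lam * ρ) (m₀ + s * t) 0 Ω δ
      (hL.continuation 0))) : PadicAlgCl p) : ℂ_[p]) * Ωp ^ (m₀ + s * t) with hV
    refine ⟨V, ?_, ?_⟩
    · rw [hH, IntSeries.hasValueAt₂_unitTwist₂_iff G ha₁' ha₂' (hnode t) hζ1]
      have e₁ : (a₁ : ℂ_[p]) * (1 + (u ^ t - 1)) - 1 = avatarValueAt r γ₁ - 1 := by rw [hr₁]; ring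
      have e₂ : (a₂ : ℂ_[p]) * (1 + (ζ - 1)) - 1 = avatarValueAt r γ₂ - 1 := by rw [hr₂]; ring
      rw [e₁, e₂]
      exact hx
    · rw [hH', IntSeries.hasValueAt₂_unitTwist₂_iff G' ha₁' ha₂' (hnode t) hζ1]
      have e₁ : (a₁ : ℂ_[p]) * (1 + (u ^ t - 1)) - 1 = avatarValueAt r γ₁ - 1 := by rw [hr₁]; ring
      have e₂ : (a₂ : ℂ_[p]) * (1 + (ζ - 1)) - 1 = avatarValueAt r γ₂ - 1 := by rw [hr₂]; ring
      rw [e₁, e₂, ← pow_mul, ← pow_add]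
      exact hx'
  -- `‖A^s‖ = 1`, hence `‖A‖ = 1` and `‖A^{m₀}‖ = 1`
  have hd : A ^ s ≠ 0 := pow_ne_zero _ hA0
  have hc : A ^ m₀ ≠ 0 := pow_ne_zero _ hA0
  have hds : ‖A ^ s‖ = 1 := IntSeries.norm_eq_one_of_torsion_nodes hu hroot hc hd n₀ hvalues hH0
  have hA1 : ‖A‖ = 1 := by
    rw [norm_pow] at hds
    exact (pow_eq_one_iff_of_nonneg (norm_nonneg A) hs.ne').mp hds
  have hc1 : ‖A ^ m₀‖ = 1 := by rw [norm_pow, hA1, one_pow]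
  -- rigidity for the twisted frames
  have hspan : Ideal.span {H'} = Ideal.span {H} :=
    IntSeries.span_eq_span_of_torsion_nodes hu hroot hc1 hd n₀ hvalues hH0
  -- twist back by `(w₁⁻¹, w₂⁻¹)`
  have hu₁n : ‖(a₁ : ℂ_[p])‖ = 1 := norm_eq_one_of_norm_sub_one_lt ha₁'
  have hu₂n : ‖(a₂ : ℂ_[p])‖ = 1 := norm_eq_one_of_norm_sub_one_lt ha₂'
  have hu₁0 : (a₁ : ℂ_[p]) ≠ 0 := fun h ↦ by rw [h, norm_zero] at hu₁n; exact zero_ne_one hu₁n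
  have hu₂0 : (a₂ : ℂ_[p]) ≠ 0 := fun h ↦ by rw [h, norm_zero] at hu₂n; exact zero_ne_one hu₂n
  set b₁ : PadicComplexInt p := ⟨(a₁ : ℂ_[p])⁻¹, mem_padicComplexInt_iff.mpr (by rw [norm_inv, hu₁n, inv_one])⟩ with hb₁
  set b₂ : PadicComplexInt p := ⟨(a₂ : ℂ_[p])⁻¹, mem_padicComplexInt_iff.mpr (by rw [norm_inv, hu₂n, inv_one])⟩ with hb₂
  have hm₁ : ‖(b₁ : ℂ_[p]) - 1‖ < 1 := by
    have : (b₁ : ℂ_[p]) - 1 = -((a₁ : ℂ_[p])⁻¹ * ((a₁ : ℂ_[p]) - 1)) := by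
      rw [mul_sub, inv_mul_cancel₀ hu₁0, mul_one]; simp [hb₁]
    rw [this, norm_neg, norm_mul, norm_inv, hu₁n, inv_one, one_mul]; exact ha₁'
  have hm₂ : ‖(b₂ : ℂ_[p]) - 1‖ < 1 := by
    have : (b₂ : ℂ_[p]) - 1 = -((a₂ : ℂ_[p])⁻¹ * ((a₂ : ℂ_[p]) - 1)) := by
      rw [mul_sub, inv_mul_cancel₀ hu₂0, mul_one]; simp [hb₂]
    rw [this, norm_neg, norm_mul, norm_inv, hu₂n, inv_one, one_mul]; exact ha₂'
  have hab₁ : a₁ * b₁ = 1 := Subtype.ext (by push_cast; simp [hb₁, mul_inv_cancel₀ hu₁0])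
  have hab₂ : a₂ * b₂ = 1 := Subtype.ext (by push_cast; simp [hb₂, mul_inv_cancel₀ hu₂0])
  have hback : ∀ F : PowerSeries (PowerSeries (PadicComplexInt p)),
      IntSeries.unitTwist₂ (IntSeries.unitTwist₂ F a₁ a₂) b₁ b₂ = F := fun F ↦ by
    rw [IntSeries.unitTwist₂_unitTwist₂ (G := F) (hu₁ := ha₁') (hu₂ := ha₂') (hu₁' := hm₁) (hu₂' := hm₂), hab₁, hab₂,
      IntSeries.unitTwist₂_one_one]
  set ψtw := IntSeries.unitTwist₂RingHom b₁ b₂ hm₁ hm₂ with hψtw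
  have hdvd : ∀ F F' : PowerSeries (PowerSeries (PadicComplexInt p)),
      IntSeries.unitTwist₂ F a₁ a₂ ∣ IntSeries.unitTwist₂ F' a₁ a₂ → F ∣ F' := by
    intro F F' ⟨U, hU⟩
    refine ⟨ψtw U, ?_⟩
    have h := congrArg ψtw hU
    rw [map_mul, hψtw, IntSeries.unitTwist₂RingHom_apply, IntSeries.unitTwist₂RingHom_apply, hback, hback] at h
    rw [h, ← hψtw]
  apply le_antisymm
  · exact Ideal.span_singleton_le_span_singleton.2 (hdvd _ _ (Ideal.span_singleton_le_span_singleton.1 hspan.le))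
  · exact Ideal.span_singleton_le_span_singleton.2 (hdvd _ _ (Ideal.span_singleton_le_span_singleton.1 hspan.ge))

/-- **The main-conjecture clause is period-independent on a frame with a torsion supply**: for any ideal `I` of `𝒪_{ℂ_p}⟦T₁⟧⟦T₂⟧`,
`I = (G) ↔ I = (G')` — the shape in which `(char X).map J = span {G₂}` is keyed by the `j = 0` twins of 24721 / 23300.
[cite: deShalit1987, II.4.12 Remarks (iii)–(iv) (p. 66–67)] -/
theorem charIdeal_clause_transport_of_isKatzMeasure₂₀_of_torsionSupply
    {ι : PadicAlgCl p ≃+* ℂ} {v vbar : HeightOneSpectrum (𝓞 K)} {S : Finset (HeightOneSpectrum (𝓞 K))}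
    {κ₁ κ₂ : ZpExtension K p} {γ₁ γ₂ : absoluteGaloisGroup K} {lam : HeckeCharacter K}
    {Ω δ Ω' δ' : ℂ} {Ωp Ωp' : ℂ_[p]} {G G' : PowerSeries (PowerSeries (PadicComplexInt p))}
    (hG : IsKatzMeasure₂₀ ι v vbar S κ₁ κ₂ γ₁ γ₂ lam Ω δ Ωp G)
    (hG' : IsKatzMeasure₂₀ ι v vbar S κ₁ κ₂ γ₁ γ₂ lam Ω' δ' Ωp' G')
    (hΩ : Ω ≠ 0) (hδ : δ ≠ 0) (hΩp : Ωp ≠ 0) (hΩ' : Ω' ≠ 0) (hΩp' : Ωp' ≠ 0) (hG0 : G ≠ 0)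
    {u w₁ w₂ : ℂ_[p]} (hu : ‖u - 1‖ < 1) (hroot : ∀ n : ℕ, 0 < n → u ^ n ≠ 1)
    (hw₁ : ‖w₁ - 1‖ < 1) (hw₂ : ‖w₂ - 1‖ < 1) {m₀ s : ℕ} (hs : 0 < s) (n₀ : ℕ)
    (hsupply : ∀ (t n : ℕ) (ζ : ℂ_[p]), n₀ < n → IsPrimitiveRoot ζ (p ^ n) →
      ∃ (ρ : HeckeCharacter K) (r : FramedGaloisRep K (PadicAlgCl p) 1),
        IsPAdicAvatarOf ι ρ r ∧ FactorsThroughPair κ₁ κ₂ r ∧ 3 ≤ m₀ + s * t ∧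
        (lam * ρ).HasInfinityType (fun _ ↦ -((m₀ + s * t : ℕ) : ℤ)) (fun _ ↦ 0) ∧
        (∀ w : HeightOneSpectrum (𝓞 K), w ∉ S → w ≠ vbar → (lam * ρ).IsUnramifiedAt w) ∧
        LFunction.HasEntireContinuation (heckeLFunction (lam * ρ)) ∧
        avatarValueAt r γ₁ = w₁ * u ^ t ∧ avatarValueAt r γ₂ = w₂ * ζ)
    (I : Ideal (PowerSeries (PowerSeries (PadicComplexInt p)))) : I = Ideal.span {G} ↔ I = Ideal.span {G'} := by
  rw [span_eq_span_of_isKatzMeasure₂₀_of_torsionSupply hG hG' hΩ hδ hΩp hΩ' hΩp' hG0 hu hroot hw₁ hw₂ hs n₀ hsupply]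

end Summit.BirchSwinnertonDyer.BirchSwinnertonDyer.Theorems.PrintCf2.KatzPeriodRigidity

end
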